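import Summits.Ventures.CertifiedManyBodySolver.Observables.PairLROTowerCeilingAuxReading
import HarnessLib

/-!
# The sharp one-point ceiling with auxiliary CHORD rows, consumers II: window-certificate soundness with auxiliary
# energy rows, and the certificate form

HONEST FRAMING: first certified bounds on pairing observables; not a superconductivity verdict; a ceiling route,
never presence; nothing in this file is a number. Crew hubbard-obs (D-0042), seat hubbard-obs-p1
(`prover-hubbard-obs-p1-g14-0`); pen RULING (hq) d261 (hq2). Zero compute; no definition beyond the section-local
`DecidableEq` shim of the sibling Literature file HubbardNNNHoppingVariationalWindowCertificate; no named fact; no `sorry`.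

* **`re_orbitState_ge_of_window_variational_certificate_d4_TT'_aux_ineq`** — window level: ONE identity in `𝔄_{Λ'}`
  `X − c·1 − Σ_σ μ_σ (n_{0σ} − ν·1) − Σ_j ρ_j (w_j·1 − δ_j⁻¹(Γ E_Φ(θ) − Γ E_Φ(θ_j))) − κ (u·1 − Γ E_Φ(θ)) = SOS + symmetry
  defects + anti-Hermitian parts + residual words` (`E_Φ(θ) = (hubbardTTPrimeFermionInteraction t t' U).meanEnergyObs 1`,
  the local energy whose translates sum to `H_L(θ)`) proves, for every `L ≥ 3` fitting the window and EVERY unit `ζ`,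
  `c − Σ‖a_k‖ + Σ_σ μ_σ(Re⟨ζ,N_σζ⟩/L² − ν) + κ(u − Re⟨ζ,H_L(θ)ζ⟩/L²) + Σ_j ρ_j(w_j − Re⟨ζ,(H_L(θ) − H_L(θ_j))ζ⟩/(δ_jL²))
   ≤ Re ω̄_ζ(Γ(ι_{Λ',L}) X)` — the auxiliary energy rows enter the torus-level variational-certificate lemma
  (`hubbardTorusTT'_re_orbitState_ge_of_variational_certificate_ineq`) as CONSERVED DENSITY rows
  `D_j = −δ_j⁻¹(Γ E_Φ(θ) − Γ E_Φ(θ_j))`, `G_j = −δ_j⁻¹(H_L(θ) − H_L(θ_j))` (space-group invariant);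
* **`liminf_pairFieldLRO_le_sq_of_onePoint_variational_certificate_TT'_aux`** — certificate form: the identity above
  for `X = −Γ(incl) Δ_g^{loc}`, `Λm ⪰ 0`, `κ ≥ 0`, `e(θ;n) ≤ u`, `U, U_j ≥ 0`, `δ_j > 0`, `ρ_j ≥ 0`, the chords
  `e(θ;n) − e(θ_j;n) ≤ δ_j w_j`, `0 < n < 2` ⇒ `liminf_k u_k ≤ (c − Σ‖a_k‖ + (Σμ)(n/2 − ν))²` for every family of unit
  `(rectN n L, 0)`-sector ground states.
References: J. Wang et al., PRX 14 (2024) 031006, §III [WangEtAl2024]; X. Han, arXiv:2006.06002, §3 [Han2020Bootstrap];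
T. Koma, H. Tasaki, J. Stat. Phys. 76 (1994) 745, Theorem 5 [KomaTasaki1994]; O. Bratteli, D. W. Robinson, *Operator
Algebras and Quantum Statistical Mechanics 2* (1997) §6.2.4 [BratteliRobinsonII1997].
-/

noncomputable section

namespace Summit.Ventures.CertifiedManyBodySolver.Observables

open Matrix Complex Finset Literature.MathematicalPhysics.QuantumLattice Literature.Probability.LatticeModels
open Literature.MathematicalPhysics.QuantumLattice.HubbardWave0 ThermodynamicLimit Filter Topology
open Literature.MathematicalPhysics.QuantumManyBody.StateRelaxation
open Summit.Ventures.CertifiedManyBodySolver.Transport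
open scoped ComplexOrder ComplexConjugate BigOperators

/-! ### §1  Window level: variational certificate with auxiliary energy rows -/

section Window

variable {L : ℕ} [NeZero L]

/-- (Local to this section: the `DecidableEq (FermionTorus 2 L)` shim of the sibling Literature file
HubbardNNNHoppingVariationalWindowCertificate.) [folklore] -/
local instance (priority := high) instDecidableEqFermionTorusVarWinAux : DecidableEq (FermionTorus 2 L) :=
  LinearOrder.toDecidableEq

/-- **Variational window certificate WITH AUXILIARY ENERGY ROWS ⇒ one-point bound in every unit vector.** Data of
`re_orbitState_ge_of_window_variational_certificate_d4_TT'_ineq` plus a finite family of auxiliary parameter points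
`θ_j = (t_j, t'_j, U_j)` with weights `ρ_j`, scales `δ_j`, targets `w_j`, entering the identity in `𝔄_{Λ'}` as
`− Σ_j ρ_j • (w_j • 1 − δ_j⁻¹ • (Γ(incl) E_Φ(θ) − Γ(incl) E_Φ(θ_j)))`. Then for every `L ≥ 3` with `x ↦ x mod L`
injective on `Λ'`, every finite `S ∋ 1` closed under multiplication with `γ_l ∈ S`, and EVERY unit vector `ζ`:
`c − Σ‖a_k‖ + Σ_σ μ_σ(Re⟨ζ,N_σζ⟩/L² − ν) + κ(u − Re⟨ζ,H_L(θ)ζ⟩/L²)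
 + Σ_j ρ_j(w_j − Re⟨ζ,(H_L(θ) − H_L(θ_j))ζ⟩/(δ_j L²)) ≤ Re ω̄_ζ(Γ(ι_{Λ',L}) X)` (no sign conditions at this level).
[cite: WangEtAl2024, §III] [cite: Han2020Bootstrap, §3] -/
theorem re_orbitState_ge_of_window_variational_certificate_d4_TT'_aux_ineq (t t' U : ℝ) (hL : 3 ≤ L)
    {Λ Λ' : Finset (Site 2)} (hΛ : Λ ⊆ Λ')
    (h0 : thicken ({0} : Finset (Site 2)) 1 ⊆ Λ') (hz : (0 : Site 2) ∈ Λ')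
    (hInj' : Set.InjOn (Torus.proj (d := 2) L) ↑Λ')
    {S : Finset (DihedralGroup 4)} (h1 : (1 : DihedralGroup 4) ∈ S) (hmul : ∀ a ∈ S, ∀ b ∈ S, a * b ∈ S)
    {ζ : Fock (Orb (FermionTorus 2 L))} (hζ1 : star ζ ⬝ᵥ ζ = 1)
    (Xw : FermionOp Λ') (κ u : ℝ) (μ : Fin 2 → ℝ) (ν : ℝ)
    {J : Type*} [Fintype J] (ta tpa Ua δa ρa wa : J → ℝ)
    {m : Type*} [Fintype m] [DecidableEq m] {Λm : Matrix m m ℂ} (hΛm : Λm.PosSemidef)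
    (O : m → FermionOp Λ')
    {ι : Type*} (tt : Finset ι) (γ : ι → DihedralGroup 4) (hγS : ∀ l ∈ tt, γ l ∈ S) (wv : ι → Site 2)
    (hsh : ∀ l, d4ShiftSet (γ l) (wv l) Λ ⊆ Λ') (Y : ι → FermionOp Λ)
    {δ : Type*} (ah : Finset δ) (dc : δ → ℝ) (V : δ → FermionOp Λ')
    {κ'' : Type*} (w : Finset κ'') (a : κ'' → ℂ) (word : κ'' → List (Orb (PolySite Λ') × Bool)) {c : ℝ}
    (hcert : Xw - (c : ℂ) • (1 : FermionOp Λ') -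
        ∑ σ : Fin 2, ((μ σ : ℝ) : ℂ) • (nAt 0 hz σ - ((ν : ℝ) : ℂ) • (1 : FermionOp Λ')) -
        ∑ j, ((ρa j : ℝ) : ℂ) • (((wa j : ℝ) : ℂ) • (1 : FermionOp Λ') -
          (((δa j)⁻¹ : ℝ) : ℂ) • (fermionEmbed (PolySite.incl h0) ((hubbardTTPrimeFermionInteraction t t' U).meanEnergyObs 1) -
            fermionEmbed (PolySite.incl h0) ((hubbardTTPrimeFermionInteraction (ta j) (tpa j) (Ua j)).meanEnergyObs 1))) -
        ((κ : ℝ) : ℂ) • (((u : ℝ) : ℂ) • (1 : FermionOp Λ') -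
          fermionEmbed (PolySite.incl h0) ((hubbardTTPrimeFermionInteraction t t' U).meanEnergyObs 1)) =
      gramForm Λm O +
        ∑ l ∈ tt, (fermionEmbed (PolySite.incl (hsh l)) (fermionEmbed (PolySite.d4Emb (γ l) (wv l) Λ) (Y l)) -
            fermionEmbed (PolySite.incl hΛ) (Y l)) +
        (∑ m' ∈ ah, ((dc m' : ℝ) : ℂ) • ((V m')ᴴ - V m') + ∑ k ∈ w, a k • ladderWord (word k))) :
    c - ∑ k ∈ w, ‖a k‖ +
        ∑ σ : Fin 2, μ σ * ((star ζ ⬝ᵥ ((∑ y : FermionTorus 2 L, numberOp y σ) *ᵥ ζ)).re / (L : ℝ) ^ 2 - ν) +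
        κ * (u - (star ζ ⬝ᵥ (hubbardTorusTT' L t t' U *ᵥ ζ)).re / (L : ℝ) ^ 2) +
        ∑ j, ρa j * (wa j -
          (star ζ ⬝ᵥ ((hubbardTorusTT' L t t' U - hubbardTorusTT' L (ta j) (tpa j) (Ua j)) *ᵥ ζ)).re /
            (δa j * (L : ℝ) ^ 2)) ≤
      (orbitState (spaceGroupUnitary S) ζ (fermionEmbed (PolySite.toTorusEmb L hInj') Xw)).re := by
  have hInjΛ : Set.InjOn (Torus.proj (d := 2) L) ↑Λ := hInj'.mono (by exact_mod_cast hΛ)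
  have hInj0 : Set.InjOn (Torus.proj (d := 2) L) ↑(thicken ({0} : Finset (Site 2)) 1) :=
    hInj'.mono (by exact_mod_cast h0)
  set Γ' := fermionEmbed (PolySite.toTorusEmb L hInj') with hΓ'
  set ΓΛ := fermionEmbed (PolySite.toTorusEmb L hInjΛ) with hΓΛ
  set H := hubbardTorusTT' L t t' U with hH
  set EΦ := (hubbardTTPrimeFermionInteraction t t' U).meanEnergyObs 1 with hEΦ
  -- the local energies `Γ(ι₀) E_Φ(θ)`, `Γ(ι₀) E_Φ(θ_j)`, whose translates sum to `H_L(θ)`, `H_L(θ_j)`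
  set X := Γ' (fermionEmbed (PolySite.incl h0) EΦ) with hX
  have hX0 : X = fermionEmbed (PolySite.toTorusEmb L hInj0) EΦ := fermionEmbed_toTorusEmb_incl h0 hInj' EΦ
  have hsum : ∑ v' : TorusSite 2 L, (fockTranslate v').val * X * (fockTranslate v').valᴴ = H := by
    rw [hX0]
    have h := sum_relabel_translate_hubbardTTPrime_meanEnergyObs (L := L) t' t U hL
    simp_rw [relabel_eq_fockRelabel_conj] at h
    exact h
  set Xj : J → Matrix (Finset (Orb (FermionTorus 2 L))) (Finset (Orb (FermionTorus 2 L))) ℂ :=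
    fun j => Γ' (fermionEmbed (PolySite.incl h0) ((hubbardTTPrimeFermionInteraction (ta j) (tpa j) (Ua j)).meanEnergyObs 1))
    with hXj
  have hsumj : ∀ j, ∑ v' : TorusSite 2 L, (fockTranslate v').val * Xj j * (fockTranslate v').valᴴ =
      hubbardTorusTT' L (ta j) (tpa j) (Ua j) := by
    intro j
    have hXj0 : Xj j = fermionEmbed (PolySite.toTorusEmb L hInj0)
        ((hubbardTTPrimeFermionInteraction (ta j) (tpa j) (Ua j)).meanEnergyObs 1) :=
      fermionEmbed_toTorusEmb_incl h0 hInj' _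
    rw [hXj0]
    have h := sum_relabel_translate_hubbardTTPrime_meanEnergyObs (L := L) (tpa j) (ta j) (Ua j) hL
    simp_rw [relabel_eq_fockRelabel_conj] at h
    exact h
  -- density observables: spin fillings and the auxiliary energy differences
  set D : Fin 2 ⊕ J → Matrix (Finset (Orb (FermionTorus 2 L))) (Finset (Orb (FermionTorus 2 L))) ℂ :=
    Sum.elim (fun σ => numberOp (FermionTorus.ofTorusSite (0 : TorusSite 2 L)) σ)
      (fun j => -((((δa j)⁻¹ : ℝ) : ℂ) • (X - Xj j))) with hD
  set G : Fin 2 ⊕ J → Matrix (Finset (Orb (FermionTorus 2 L))) (Finset (Orb (FermionTorus 2 L))) ℂ :=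
    Sum.elim (fun σ => ∑ y : FermionTorus 2 L, numberOp y σ)
      (fun j => -((((δa j)⁻¹ : ℝ) : ℂ) • (H - hubbardTorusTT' L (ta j) (tpa j) (Ua j)))) with hG
  set μ' : Fin 2 ⊕ J → ℝ := Sum.elim μ ρa with hμ'
  set ν' : Fin 2 ⊕ J → ℝ := Sum.elim (fun _ => ν) (fun j => -wa j) with hν'
  have hDΓ : ∀ σ, Γ' (nAt 0 hz σ) = D (Sum.inl σ) := fun σ => fermionEmbed_toTorusEmb_nAt_zero hz hInj' σ
  have hDsum : ∀ i ∈ (Finset.univ : Finset (Fin 2 ⊕ J)),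
      ∑ v' : TorusSite 2 L, (fockTranslate v').val * D i * (fockTranslate v').valᴴ = G i := by
    rintro (σ | j) -
    · exact sum_conj_fockTranslate_numberOp 0 σ
    · simp only [hD, hG, Sum.elim_inr]
      simp_rw [Matrix.mul_neg, Matrix.neg_mul, Matrix.mul_smul, Matrix.smul_mul, Matrix.mul_sub, Matrix.sub_mul,
        Finset.sum_neg_distrib, ← Finset.smul_sum, Finset.sum_sub_distrib, hsum, hsumj j]
  have hGT : ∀ i ∈ (Finset.univ : Finset (Fin 2 ⊕ J)), ∀ g : TorusSite 2 L × ↥S,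
      spaceGroupUnitary S g * G i = G i * spaceGroupUnitary S g := by
    rintro (σ | j) - g
    · exact spaceGroupUnitary_commute_spinNumber S g σ
    · simp only [hG, Sum.elim_inr]
      rw [Matrix.mul_neg, Matrix.neg_mul, Matrix.mul_smul, Matrix.smul_mul, Matrix.mul_sub, Matrix.sub_mul,
        spaceGroupUnitary_mul_hubbardTorusTT' S t t' U g,
        spaceGroupUnitary_mul_hubbardTorusTT' S (ta j) (tpa j) (Ua j) g]
  -- symmetry family: affine `D₄` maps, as torus matrices
  set Yt : ι → Matrix (Finset (Orb (FermionTorus 2 L))) (Finset (Orb (FermionTorus 2 L))) ℂ :=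
    fun l => ΓΛ (Y l) with hYt
  -- residual words
  set emb : Orb (PolySite Λ') × Bool → Orb (FermionTorus 2 L) × Bool :=
    fun p => (Orb.embMap (PolySite.toTorusEmb L hInj') p.1, p.2) with hemb
  set M : κ'' → Matrix (Finset (Orb (FermionTorus 2 L))) (Finset (Orb (FermionTorus 2 L))) ℂ :=
    fun k => ladderWord ((word k).map emb) with hM
  have hMc : ∀ k ∈ w, (M k).IsContraction := fun k _ => by
    rw [hM]; dsimp only; rw [ladderWord_eq_prod]; exact isContraction_prod_ladder _
  -- the left-hand side, pulled back into the torus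
  have hs : Γ' (∑ σ : Fin 2, ((μ σ : ℝ) : ℂ) • (nAt 0 hz σ - ((ν : ℝ) : ℂ) • (1 : FermionOp Λ'))) =
      ∑ σ : Fin 2, ((μ' (Sum.inl σ) : ℝ) : ℂ) • (D (Sum.inl σ) - ((ν' (Sum.inl σ) : ℝ) : ℂ) •
        (1 : Matrix (Finset (Orb (FermionTorus 2 L))) (Finset (Orb (FermionTorus 2 L))) ℂ)) := by
    rw [map_sum]
    exact Finset.sum_congr rfl fun σ _ => by
      rw [map_smul, map_sub, map_smul, map_one, hDΓ]; simp only [hμ', hν', Sum.elim_inl]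
  have hsa : Γ' (∑ j, ((ρa j : ℝ) : ℂ) • (((wa j : ℝ) : ℂ) • (1 : FermionOp Λ') -
        (((δa j)⁻¹ : ℝ) : ℂ) • (fermionEmbed (PolySite.incl h0) EΦ -
          fermionEmbed (PolySite.incl h0) ((hubbardTTPrimeFermionInteraction (ta j) (tpa j) (Ua j)).meanEnergyObs 1)))) =
      ∑ j, ((μ' (Sum.inr j) : ℝ) : ℂ) • (D (Sum.inr j) - ((ν' (Sum.inr j) : ℝ) : ℂ) •
        (1 : Matrix (Finset (Orb (FermionTorus 2 L))) (Finset (Orb (FermionTorus 2 L))) ℂ)) := by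
    rw [map_sum]
    refine Finset.sum_congr rfl fun j _ => ?_
    rw [map_smul, map_sub, map_smul, map_one, map_smul, map_sub]
    simp only [hμ', hν', hD, Sum.elim_inr, hX, hXj]
    rw [Complex.ofReal_neg, neg_smul, sub_neg_eq_add]
    abel_nf
  have hk : Γ' (((κ : ℝ) : ℂ) • (((u : ℝ) : ℂ) • (1 : FermionOp Λ') - fermionEmbed (PolySite.incl h0) EΦ)) =
      ((κ : ℝ) : ℂ) • (((u : ℝ) : ℂ) •
        (1 : Matrix (Finset (Orb (FermionTorus 2 L))) (Finset (Orb (FermionTorus 2 L))) ℂ) - X) := by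
    rw [map_smul, map_sub, map_smul, map_one, hX]
  have hlhs : Γ' (Xw - (c : ℂ) • (1 : FermionOp Λ') -
        ∑ σ : Fin 2, ((μ σ : ℝ) : ℂ) • (nAt 0 hz σ - ((ν : ℝ) : ℂ) • (1 : FermionOp Λ')) -
        ∑ j, ((ρa j : ℝ) : ℂ) • (((wa j : ℝ) : ℂ) • (1 : FermionOp Λ') -
          (((δa j)⁻¹ : ℝ) : ℂ) • (fermionEmbed (PolySite.incl h0) EΦ -
            fermionEmbed (PolySite.incl h0) ((hubbardTTPrimeFermionInteraction (ta j) (tpa j) (Ua j)).meanEnergyObs 1))) -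
        ((κ : ℝ) : ℂ) • (((u : ℝ) : ℂ) • (1 : FermionOp Λ') - fermionEmbed (PolySite.incl h0) EΦ)) =
      Γ' Xw - (c : ℂ) • (1 : Matrix (Finset (Orb (FermionTorus 2 L))) (Finset (Orb (FermionTorus 2 L))) ℂ) -
        ∑ i ∈ (Finset.univ : Finset (Fin 2 ⊕ J)), ((μ' i : ℝ) : ℂ) • (D i - ((ν' i : ℝ) : ℂ) •
          (1 : Matrix (Finset (Orb (FermionTorus 2 L))) (Finset (Orb (FermionTorus 2 L))) ℂ)) -
        ((κ : ℝ) : ℂ) • (((u : ℝ) : ℂ) •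
          (1 : Matrix (Finset (Orb (FermionTorus 2 L))) (Finset (Orb (FermionTorus 2 L))) ℂ) - X) := by
    rw [map_sub, hk, map_sub, hsa, map_sub, hs, map_sub, map_smul, map_one, Fintype.sum_sum_type]
    abel
  -- the identity, pulled back into the torus (empty sector and charge families)
  have htorus : Γ' Xw - (c : ℂ) • (1 : Matrix (Finset (Orb (FermionTorus 2 L))) (Finset (Orb (FermionTorus 2 L))) ℂ) -
      ∑ i ∈ (Finset.univ : Finset (Fin 2 ⊕ J)), ((μ' i : ℝ) : ℂ) • (D i - ((ν' i : ℝ) : ℂ) •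
        (1 : Matrix (Finset (Orb (FermionTorus 2 L))) (Finset (Orb (FermionTorus 2 L))) ℂ)) -
      ((κ : ℝ) : ℂ) • (((u : ℝ) : ℂ) •
        (1 : Matrix (Finset (Orb (FermionTorus 2 L))) (Finset (Orb (FermionTorus 2 L))) ℂ) - X) =
      gramForm Λm (fun i => Γ' (O i)) +
        (∑ l ∈ tt, ((fockTranslate (Torus.proj L (wv l))).val * (fockD4 (L := L) (γ l)).val * Yt l *
              ((fockTranslate (Torus.proj L (wv l))).val * (fockD4 (L := L) (γ l)).val)ᴴ - Yt l) +
          ∑ i ∈ (∅ : Finset (Fin 0)), ((0 : Matrix _ _ ℂ) * ((0 : Matrix _ _ ℂ) - (((0 : ℝ) : ℝ) : ℂ) • 1) +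
            ((0 : Matrix _ _ ℂ) - (((0 : ℝ) : ℝ) : ℂ) • 1) * (0 : Matrix _ _ ℂ)) +
          ∑ j ∈ (∅ : Finset (Fin 0)), ((0 : Matrix _ _ ℂ) * (0 : Matrix _ _ ℂ) - (0 : Matrix _ _ ℂ) * (0 : Matrix _ _ ℂ))) +
        (∑ m' ∈ ah, ((dc m' : ℝ) : ℂ) • ((Γ' (V m'))ᴴ - Γ' (V m')) + ∑ k ∈ w, a k • M k) := by
    have key := congrArg Γ' hcert
    rw [hlhs] at key
    have h2 : Γ' (∑ l ∈ tt, (fermionEmbed (PolySite.incl (hsh l)) (fermionEmbed (PolySite.d4Emb (γ l) (wv l) Λ) (Y l)) -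
        fermionEmbed (PolySite.incl hΛ) (Y l))) =
        ∑ l ∈ tt, ((fockTranslate (Torus.proj L (wv l))).val * (fockD4 (L := L) (γ l)).val * Yt l *
          ((fockTranslate (Torus.proj L (wv l))).val * (fockD4 (L := L) (γ l)).val)ᴴ - Yt l) := by
      rw [map_sum]
      refine Finset.sum_congr rfl fun l _ => ?_
      rw [hYt, hΓΛ, hΓ']
      exact fermionEmbed_toTorusEmb_d4_sub hΛ (γ l) (wv l) (hsh l) hInj' (Y l)
    have h4 : Γ' (∑ m' ∈ ah, ((dc m' : ℝ) : ℂ) • ((V m')ᴴ - V m')) =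
        ∑ m' ∈ ah, ((dc m' : ℝ) : ℂ) • ((Γ' (V m'))ᴴ - Γ' (V m')) := by
      rw [map_sum]
      refine Finset.sum_congr rfl fun m' _ => ?_
      rw [map_smul, map_sub, hΓ', fermionEmbed_conjTranspose]
    have h5 : Γ' (∑ k ∈ w, a k • ladderWord (word k)) = ∑ k ∈ w, a k • M k := by
      rw [map_sum]
      refine Finset.sum_congr rfl fun k _ => ?_
      rw [map_smul, hM, hΓ', fermionEmbed_ladderWord]
    rw [key, map_add, map_add, map_add, hΓ', fermionEmbed_gramForm, ← hΓ', h2, h4, h5,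
      Finset.sum_empty, Finset.sum_empty, add_zero, add_zero]
  have hmain := hubbardTorusTT'_re_orbitState_ge_of_variational_certificate_ineq t t' U h1 hmul ⊤
    (fun _ _ _ => Submodule.mem_top) (Submodule.mem_top : ζ ∈ (⊤ : Submodule ℂ _)) hζ1
    (Γ' Xw) X hsum κ u (Finset.univ : Finset (Fin 2 ⊕ J)) μ' ν' D G hDsum hGT hΛm
    (fun i => Γ' (O i)) tt γ hγS (fun l => Torus.proj L (wv l)) Yt
    (∅ : Finset (Fin 0)) (fun _ => 0) (fun _ => 0) (fun _ => 0) (fun _ => 0)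
    (fun i hi => absurd hi (Finset.notMem_empty i)) (fun i hi => absurd hi (Finset.notMem_empty i))
    (∅ : Finset (Fin 0)) (fun _ => 0) (fun _ => 0) (fun _ => 0)
    (fun i hi => absurd hi (Finset.notMem_empty i)) (fun i hi => absurd hi (Finset.notMem_empty i))
    ah dc (fun m' => Γ' (V m')) w a M hMc htorus
  -- read the `Fin 2 ⊕ J` sum
  have hsplit : ∑ i ∈ (Finset.univ : Finset (Fin 2 ⊕ J)), μ' i * ((star ζ ⬝ᵥ (G i *ᵥ ζ)).re / (L : ℝ) ^ 2 - ν' i) =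
      ∑ σ : Fin 2, μ σ * ((star ζ ⬝ᵥ ((∑ y : FermionTorus 2 L, numberOp y σ) *ᵥ ζ)).re / (L : ℝ) ^ 2 - ν) +
      ∑ j, ρa j * (wa j -
        (star ζ ⬝ᵥ ((H - hubbardTorusTT' L (ta j) (tpa j) (Ua j)) *ᵥ ζ)).re / (δa j * (L : ℝ) ^ 2)) := by
    rw [Fintype.sum_sum_type]
    congr 1
    refine Finset.sum_congr rfl fun j _ => ?_
    simp only [hμ', hν', hG, Sum.elim_inr]
    rw [Matrix.neg_mulVec, dotProduct_neg, Complex.neg_re, Matrix.smul_mulVec, dotProduct_smul, smul_eq_mul,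
      Complex.re_ofReal_mul]
    ring
  rw [hsplit] at hmain
  linarith [hmain]

end Window

/-! ### §2  Families of sector ground states: the certificate form with auxiliary chord rows -/

section Family

variable (g : Site 2 → ℝ)

/-- **OP1-E window certificate WITH AUXILIARY CHORD ROWS ⇒ `liminf_k u_k ≤ M²` (sharp), `t–t'` model.** One identity
in `𝔄_{Λ'}` (the shape of `re_orbitState_ge_of_window_variational_certificate_d4_TT'_aux_ineq` for `X = −Γ(incl) Δ_g^{loc}`,
`Δ_g` invariant under `S ∋ 1` closed under multiplication), `Λm ⪰ 0`, `κ ≥ 0`, `e(θ;n) ≤ u`, `U ≥ 0`, `0 < n < 2`, and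
the auxiliary data `θ_j = (t_j,t'_j,U_j)` (`U_j ≥ 0`), `δ_j > 0`, `ρ_j ≥ 0`, `w_j` with the CHORD premises
`e(θ;n) − e(θ_j;n) ≤ δ_j w_j` (certified energy rows at `θ` and `θ_j` BY NAME) give
`liminf_k u_k ≤ (c − Σ‖a_k‖ + (Σμ)(n/2 − ν))²` for every family of unit `(rectN n L, 0)`-sector ground states of
`H_L(θ)`. The box / product certificates of the (gb1) pattern are instances (letter boxes on `D/L²`, `T₂/L²` as
`U`- and `t'`-shifts of `H`). [cite: KomaTasaki1994, Theorem 5] [cite: WangEtAl2024, §III] [cite: Han2020Bootstrap, §3] -/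
theorem liminf_pairFieldLRO_le_sq_of_onePoint_variational_certificate_TT'_aux (t t' : ℝ) {U n : ℝ} (hU : 0 ≤ U)
    (hn0 : 0 < n) (hn2 : n < 2) {κ u : ℝ} (hκ : 0 ≤ κ) (hu : energyDensityTT' t t' U n ≤ u)
    {J : Type*} [Fintype J] (ta tpa Ua δa ρa wa : J → ℝ) (hUa : ∀ j, 0 ≤ Ua j) (hδa : ∀ j, 0 < δa j)
    (hρa : ∀ j, 0 ≤ ρa j)
    (hwa : ∀ j, energyDensityTT' t t' U n - energyDensityTT' (ta j) (tpa j) (Ua j) n ≤ δa j * wa j)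
    {Λ Λ' : Finset (Site 2)} (hΛ : Λ ⊆ Λ')
    (h0 : thicken ({0} : Finset (Site 2)) 1 ⊆ Λ') (hz : (0 : Site 2) ∈ Λ')
    (hP : pairRegion (insert (0 : Site 2) unitSteps) 0 ⊆ Λ')
    {S : Finset (DihedralGroup 4)} (h1 : (1 : DihedralGroup 4) ∈ S) (hmul : ∀ a ∈ S, ∀ b ∈ S, a * b ∈ S)
    (hg : ∀ γ ∈ S, ∀ e ∈ insert (0 : Site 2) unitSteps, g (d4Vec γ e) = g e)
    (μ : Fin 2 → ℝ) (ν : ℝ)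
    {m : Type*} [Fintype m] [DecidableEq m] {Λm : Matrix m m ℂ} (hΛm : Λm.PosSemidef)
    (O : m → FermionOp Λ')
    {ι : Type*} (tt : Finset ι) (γ : ι → DihedralGroup 4) (hγS : ∀ l ∈ tt, γ l ∈ S) (wv : ι → Site 2)
    (hsh : ∀ l, d4ShiftSet (γ l) (wv l) Λ ⊆ Λ') (Y : ι → FermionOp Λ)
    {δ : Type*} (ah : Finset δ) (dc : δ → ℝ) (V : δ → FermionOp Λ')
    {κ'' : Type*} (w : Finset κ'') (a : κ'' → ℂ) (word : κ'' → List (Orb (PolySite Λ') × Bool)) {c : ℝ}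
    (hcert : -(fermionEmbed (PolySite.incl hP) (localPairAt (insert (0 : Site 2) unitSteps) g 0)) -
        (c : ℂ) • (1 : FermionOp Λ') -
        ∑ σ : Fin 2, ((μ σ : ℝ) : ℂ) • (nAt 0 hz σ - ((ν : ℝ) : ℂ) • (1 : FermionOp Λ')) -
        ∑ j, ((ρa j : ℝ) : ℂ) • (((wa j : ℝ) : ℂ) • (1 : FermionOp Λ') -
          (((δa j)⁻¹ : ℝ) : ℂ) • (fermionEmbed (PolySite.incl h0) ((hubbardTTPrimeFermionInteraction t t' U).meanEnergyObs 1) -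
            fermionEmbed (PolySite.incl h0) ((hubbardTTPrimeFermionInteraction (ta j) (tpa j) (Ua j)).meanEnergyObs 1))) -
        ((κ : ℝ) : ℂ) • (((u : ℝ) : ℂ) • (1 : FermionOp Λ') -
          fermionEmbed (PolySite.incl h0) ((hubbardTTPrimeFermionInteraction t t' U).meanEnergyObs 1)) =
      gramForm Λm O +
        ∑ l ∈ tt, (fermionEmbed (PolySite.incl (hsh l)) (fermionEmbed (PolySite.d4Emb (γ l) (wv l) Λ) (Y l)) -
            fermionEmbed (PolySite.incl hΛ) (Y l)) +
        (∑ m' ∈ ah, ((dc m' : ℝ) : ℂ) • ((V m')ᴴ - V m') + ∑ k ∈ w, a k • ladderWord (word k)))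
    (ψ : ∀ L, Fock (Orb (FermionTorus 2 L)))
    (hψ : ∀ L, IsGroundStateInSector (hubbardTorusTT' L t t' U) (rectN n L) 0 (ψ L))
    (hψ1 : ∀ L, star (ψ L) ⬝ᵥ ψ L = 1) :
    liminf (fun k : ℕ => (∑ x ∈ halfOpenBox 2 (2 * k), ∑ y ∈ halfOpenBox 2 (2 * k),
        torusPullback (pairFieldCorr g ψ) (2 * k) x y) / ((#(halfOpenBox 2 (2 * k)) : ℝ)) ^ 2) atTop ≤
      (c - ∑ k ∈ w, ‖a k‖ + (∑ σ : Fin 2, μ σ) * (n / 2 - ν)) ^ 2 := by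
  obtain ⟨L₀, hL₀⟩ := exists_forall_le_injOn_proj (d := 2) Λ'
  have hInj : ∀ L : ℕ, max L₀ 3 ≤ L → Set.InjOn (Torus.proj (d := 2) L) ↑Λ' :=
    fun L hL => hL₀ L (le_trans (le_max_left _ _) hL)
  refine liminf_pairFieldLRO_le_sq_of_onePoint_orbitState_bound_TT'_aux g t t' hU hn0 hn2 μ hκ hu
    ta tpa Ua δa ρa wa hUa hδa hρa hwa ⟨1, h1⟩ hg hP (max L₀ 3) hInj ?_ ψ hψ hψ1
  intro L _ hL ζ hζ
  have hL3 : 3 ≤ L := le_trans (le_max_right _ _) hL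
  exact re_orbitState_ge_of_window_variational_certificate_d4_TT'_aux_ineq t t' U hL3 hΛ h0 hz (hInj L hL)
    h1 hmul hζ (-(fermionEmbed (PolySite.incl hP) (localPairAt (insert (0 : Site 2) unitSteps) g 0)))
    κ u μ ν ta tpa Ua δa ρa wa hΛm O tt γ hγS wv hsh Y ah dc V w a word hcert

end Family

end Summit.Ventures.CertifiedManyBodySolver.Observables

end
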